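import Mathlib
import HarnessLib
import Summits.ValiantsHypothesis.ValiantsHypothesis.Theorems.MonotoneRestorationOrbitRestorationQPSmlAffineOrbitInstance
import Summits.ValiantsHypothesis.ValiantsHypothesis.Theorems.BarrierLeverNaturalProofsSeparateVNPSignSliceCRT

/-!
# The permanent needs `2^{⌊n/3⌋}` product gates in any affine column- or row-set-multilinear `ΣΠΣ` expression
(crux `OrbitRestorationQP`, stmt-ValiantsHypothesis-18293 — lane SML of stub A_∞; explicit exponential form of
`SmlAffinePermanent.perm_affineColSml_lower_bound` / `SmlAffineRestoration.perm_affineRowSml_lower_bound`)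

With `j = ⌊n/3⌋` one has `2j ≤ n` and `n - j ≥ 2j`, so `C(n-j, j) ≥ C(2j, j) = centralBinom j ≥ 2^j`:

* `two_pow_div_three_le_choose` — `2^{⌊n/3⌋} ≤ C(n-⌊n/3⌋, ⌊n/3⌋)` (tree: `BarrierLever.NaturalProofsSeparateVNP.CRT.two_pow_le_centralBinom`);
* `perm_affineColSml_two_pow_le`, `perm_affineRowSml_two_pow_le` — **every affine column- (row-) set-multilinear depth-three
  expression of `per_n` has at least `2^{⌊n/3⌋}` product gates.**

Honest label: explicit form of a restricted-model lower bound; nothing here bears on general `ΣΠΣ` or on VP ≠ VNP. [folklore]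
-/

noncomputable section

open scoped Classical

-- `Summit.ValiantsHypothesis.ValiantsHypothesis.…` is the tree's single-conjunct layout (Sub = Summit).
set_option linter.dupNamespace false

namespace Summit.ValiantsHypothesis.ValiantsHypothesis.Theorems.SmlAffinePermanent

open MvPolynomial Finset Literature.Computability.AlgebraicComplexity SmlAffineRestoration

/-- `2^{⌊n/3⌋} ≤ C(n - ⌊n/3⌋, ⌊n/3⌋)`. [folklore] -/
theorem two_pow_div_three_le_choose (n : ℕ) : 2 ^ (n / 3) ≤ Nat.choose (n - n / 3) (n / 3) :=
  calc 2 ^ (n / 3) ≤ Nat.centralBinom (n / 3) := BarrierLever.NaturalProofsSeparateVNP.CRT.two_pow_le_centralBinom _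
    _ = Nat.choose (2 * (n / 3)) (n / 3) := Nat.centralBinom_eq_two_mul_choose _
    _ ≤ Nat.choose (n - n / 3) (n / 3) := Nat.choose_le_choose _ (by omega)

/-- **`per_n` needs `≥ 2^{⌊n/3⌋}` product gates in any affine column-set-multilinear `ΣΠΣ` expression.** [folklore] -/
theorem perm_affineColSml_two_pow_le {n s : ℕ} (β : Fin s → Fin n → ℂ) (α : Fin s → Fin n → Fin n → ℂ)
    (hper : (∑ t : Fin s, ∏ b : Fin n, (C (β t b) + ∑ a : Fin n, C (α t b a) * X (a, b)) :
      MvPolynomial (Fin n × Fin n) ℂ) = perPoly (Fin n) ℂ) :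
    2 ^ (n / 3) ≤ s :=
  (two_pow_div_three_le_choose n).trans (perm_affineColSml_lower_bound (j := n / 3) (by omega) β α hper)

/-- **`per_n` needs `≥ 2^{⌊n/3⌋}` product gates in any affine row-set-multilinear `ΣΠΣ` expression.** [folklore] -/
theorem perm_affineRowSml_two_pow_le {n s : ℕ} (β : Fin s → Fin n → ℂ) (α : Fin s → Fin n → Fin n → ℂ)
    (hper : (∑ t : Fin s, ∏ a : Fin n, (C (β t a) + ∑ b : Fin n, C (α t a b) * X (a, b)) :
      MvPolynomial (Fin n × Fin n) ℂ) = perPoly (Fin n) ℂ) :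
    2 ^ (n / 3) ≤ s :=
  (two_pow_div_three_le_choose n).trans (perm_affineRowSml_lower_bound (j := n / 3) (by omega) β α hper)

end Summit.ValiantsHypothesis.ValiantsHypothesis.Theorems.SmlAffinePermanent

end
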